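import Summits.BirchSwinnertonDyer.Rank1Residual.X12.CMRamifiedRecordSchemaHSatMeaning
import Literature.NumberTheory.EllipticCurves.VariableChangePointsMap
import HarnessLib

/-!
# Leaf `CornerF ∧ CMRamified`, slice `p = 3`: PART H-Sat — the displayed hypothesis `h9` DISCHARGED:
# no rational point of order `9` on `y² = x³ + k`, so a passing member record gives
# «`G ∉ 3·E_k(ℚ) + E_k(ℚ)_tors`» unconditionally

HONEST FRAMING (cell `bsd-print-cfram`, run/shared/lean/pub/bsd-print-cfram/, verbatim in every file
of the cell): PARTITION currency only — the leaf counts when its class theorem is in the kernel BY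
NAME, flag-free; Literature named facts are statement-only with cite tags, never sorried theorems;
every imported theorem carries its printed hypotheses verbatim; numbers, not adjectives. THIS FILE IS
STRUCTURE: theorems only, no definition, no named fact, nothing about any particular curve; no mark
moves (regime child T = stmt-BirchSwinnertonDyer-20699 of route `PrintCFram` stays OPEN).

WHAT IS HERE. `X12/CMRamifiedRecordSchemaHSatMeaning.lean` proves `memberOK_sound_torsion` under the
displayed hypothesis `h9 : ∀ t ∈ E_k(ℚ), 9t = O → 3t = O`. This file discharges `h9` for every `k ≠ 0`
from p3's field-generic `PrintCFram.NoZetaNine.three_smul_eq_zero_of_nine_smul_eq_zero` (no point of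
order `9` on `y² = x³ + k` over a field containing `√−3` and no primitive ninth root of unity), applied
over `L = ℚ(ζ₃)` (`CyclotomicField 3 ℚ`: `√−3 = 2ζ₃ + 1`; its roots of unity are `±ζ₃^r` —
Mathlib `IsPrimitiveRoot.exists_pow_or_neg_mul_pow_of_isOfFinOrder` — so `z⁹ = 1 ⇒ z³ = 1`), and the
injective base-change homomorphism `E_k(ℚ) → E_k(L)` (Mathlib `Affine.Point.baseChange`, tree
`Affine.Point.congrEquiv`):
* `pow_three_eq_one_of_pow_nine_eq_one_cyclotomicThree`, `exists_sq_eq_neg_three_cyclotomicThree`,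
  `three_smul_eq_zero_of_nine_smul_eq_zero_rat_aux` (any `[IsCyclotomicExtension {3} ℚ L]`);
* **`three_smul_eq_zero_of_nine_smul_eq_zero_rat`** — `k ≠ 0`, `t ∈ E_k(ℚ)`, `9t = O ⇒ 3t = O`
  (so `E_k(ℚ)[3^∞] = E_k(ℚ)[3]`, [cite: SilvermanAEC2009, Exercise 10.19] for the torsion of `y² = x³ + D`);
* **`memberOK_sound_allTorsion`**, **`HSatRow.sound_allTorsion_of_ok`** — for a passing member record /
  both members of an `ok` row: `3Q + t ≠ G` for every rational `Q` and every rational TORSION point `t`,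
  i.e. the recorded generator `G = (X/d², Y/d³)` is not in `3·E_k(ℚ) + E_k(ℚ)_tors`. With `rank E_k(ℚ) = 1`
  (the route's named facts) this is `3 ∤ [E_k(ℚ) : ℤG + E_k(ℚ)_tors]`: PART H's `ntilde` column is the level of
  every generator modulo torsion — the binder of `X12.O11.RamifiedCMEllipticUnitIndexAtThreeT`.
beyond-print: NO.
-/

set_option autoImplicit false

noncomputable section

open scoped Classical
open WeierstrassCurve Polynomial Literature.NumberTheory.EllipticCurves

namespace Summit.BirchSwinnertonDyer.Rank1Residual.X12.CMRamifiedRecords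

/-! ## §1 `ℚ(ζ₃)`: `√−3` and no primitive ninth root of unity -/

section Cyclotomic

variable {L : Type*} [Field L] [NumberField L] [IsCyclotomicExtension {3} ℚ L]

/-- In a third cyclotomic extension of `ℚ` every `z` with `z⁹ = 1` has `z³ = 1`: its roots of unity are
`±ζ₃^r` (Mathlib), and `(−ζ₃^r)⁹ = −1 ≠ 1`. [folklore] -/
theorem pow_three_eq_one_of_pow_nine_eq_one_cyclotomicThree (z : L) (h9 : z ^ 9 = 1) : z ^ 3 = 1 := by
  have hζ : IsPrimitiveRoot (IsCyclotomicExtension.zeta 3 ℚ L) 3 := IsCyclotomicExtension.zeta_spec 3 ℚ L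
  set ζ := IsCyclotomicExtension.zeta 3 ℚ L with hζdef
  have hfin : IsOfFinOrder z := isOfFinOrder_iff_pow_eq_one.mpr ⟨9, by norm_num, h9⟩
  have hpow : ∀ r : ℕ, (ζ ^ r) ^ 9 = 1 := fun r => by
    rw [← pow_mul, show r * 9 = 3 * (3 * r) by ring, pow_mul, hζ.pow_eq_one, one_pow]
  obtain ⟨r, -, hr | hr⟩ := hζ.exists_pow_or_neg_mul_pow_of_isOfFinOrder (by decide : Odd 3) hfin
  · rw [hr, ← pow_mul, show r * 3 = 3 * r by ring, pow_mul, hζ.pow_eq_one, one_pow]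
  · exfalso
    have h1 : z ^ 9 = -1 := by rw [hr, neg_pow, hpow r]; norm_num
    rw [h9] at h1
    have h2 : (2 : L) = 0 := by linear_combination h1
    exact two_ne_zero h2

/-- `√−3` in a third cyclotomic extension of `ℚ`: `(2ζ₃ + 1)² = −3`. [folklore] -/
theorem exists_sq_eq_neg_three_cyclotomicThree : ∃ θ : L, θ ^ 2 = -3 := by
  have hζ : IsPrimitiveRoot (IsCyclotomicExtension.zeta 3 ℚ L) 3 := IsCyclotomicExtension.zeta_spec 3 ℚ L
  set ζ := IsCyclotomicExtension.zeta 3 ℚ L with hζdef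
  have h3 : ζ ^ 3 = 1 := hζ.pow_eq_one
  have h1 : ζ ≠ 1 := hζ.ne_one (by norm_num)
  have hq : ζ ^ 2 + ζ + 1 = 0 := by
    have hprod : (ζ - 1) * (ζ ^ 2 + ζ + 1) = 0 := by linear_combination h3
    exact (mul_eq_zero.mp hprod).resolve_left (sub_ne_zero.mpr h1)
  exact ⟨2 * ζ + 1, by linear_combination 4 * hq⟩

/-- `9t = O ⇒ 3t = O` for every rational point `t` of `y² = x³ + k` (`k ≠ 0`), by base change to a third
cyclotomic extension `L` of `ℚ` and p3's field-generic theorem there. [cite: SilvermanAEC2009, Exercise 10.19] -/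
theorem three_smul_eq_zero_of_nine_smul_eq_zero_rat_aux (L : Type*) [Field L] [NumberField L]
    [IsCyclotomicExtension {3} ℚ L] {k : ℚ} (hk : k ≠ 0)
    (t : (mordellCurve k).toAffine.Point) (h9 : (9 : ℕ) • t = 0) : (3 : ℕ) • t = 0 := by
  obtain ⟨θ, hθ⟩ := exists_sq_eq_neg_three_cyclotomicThree (L := L)
  have hkL : algebraMap ℚ L k ≠ 0 := (map_ne_zero_iff _ (algebraMap ℚ L).injective).mpr hk
  have e₁ : (mordellCurve k).baseChange ℚ = mordellCurve k := by
    rw [mordellCurve_baseChange]; rfl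
  have e₂ : (mordellCurve k).baseChange L = mordellCurve (algebraMap ℚ L k) := mordellCurve_baseChange k L
  let ε : (mordellCurve k).toAffine.Point →+ (mordellCurve (algebraMap ℚ L k)).toAffine.Point :=
    (Affine.Point.congrEquiv e₂).toAddMonoidHom.comp
      ((Affine.Point.baseChange (W' := mordellCurve k) ℚ L).comp
        (Affine.Point.congrEquiv e₁).symm.toAddMonoidHom)
  have hε : Function.Injective ε :=
    (Affine.Point.congrEquiv e₂).injective.comp
      ((Affine.Point.map_injective _).comp (Affine.Point.congrEquiv e₁).symm.injective)
  have h9' : (9 : ℕ) • ε t = 0 := by rw [← map_nsmul, h9, map_zero]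
  have h3' := Summit.BirchSwinnertonDyer.BirchSwinnertonDyer.Theorems.PrintCFram.NoZetaNine.three_smul_eq_zero_of_nine_smul_eq_zero
    hθ pow_three_eq_one_of_pow_nine_eq_one_cyclotomicThree hkL (ε t) h9'
  rw [← map_nsmul] at h3'
  exact (map_eq_zero_iff ε hε).mp h3'

end Cyclotomic

/-! ## §2 No rational point of order `9` on `y² = x³ + k` -/

set_option backward.isDefEq.respectTransparency false in
/-- **`9t = O ⇒ 3t = O` for every rational point `t` of `y² = x³ + k`, `k ≠ 0`** (p3's
`NoZetaNine.three_smul_eq_zero_of_nine_smul_eq_zero` over `ℚ(ζ₃) = CyclotomicField 3 ℚ`, pulled back along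
the injective base change `E_k(ℚ) → E_k(ℚ(ζ₃))`). Hence `E_k(ℚ)[3^∞] = E_k(ℚ)[3]`. [cite: SilvermanAEC2009, Exercise 10.19] -/
theorem three_smul_eq_zero_of_nine_smul_eq_zero_rat {k : ℚ} (hk : k ≠ 0)
    (t : (mordellCurve k).toAffine.Point) (h9 : (9 : ℕ) • t = 0) : (3 : ℕ) • t = 0 := by
  -- as in Mathlib's `fermatLastTheoremThree`: `K = CyclotomicField 3 ℚ` with its instances
  let K := CyclotomicField 3 ℚ
  have : NumberField K := IsCyclotomicExtension.numberField {3} ℚ _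
  exact three_smul_eq_zero_of_nine_smul_eq_zero_rat_aux K hk t h9

/-! ## §3 The member record, all torsion -/

/-- **`3Q + t ≠ G` for every rational `Q` and every rational TORSION point `t`** — a passing member record's
recorded point `G = (X/d², Y/d³)` is not in `3·E_k(ℚ) + E_k(ℚ)_tors` (`memberOK_sound_torsion` with `h9`
discharged by `three_smul_eq_zero_of_nine_smul_eq_zero_rat`). [folklore] -/
theorem memberOK_sound_allTorsion {k X Y : ℤ} {d p₀ s pp pm q₁ q₂ q₃ : ℕ}
    (h : memberOK k X Y d p₀ s pp pm q₁ q₂ q₃ = true)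
    {t : (mordellCurve (k : ℚ)).toAffine.Point} (ht : IsOfFinAddOrder t)
    (Q : (mordellCurve (k : ℚ)).toAffine.Point) :
    (3 : ℕ) • Q + t ≠ .some _ _ (nonsingular_gen_of_memberOK h) :=
  memberOK_sound_torsion h
    (fun t' h9 => three_smul_eq_zero_of_nine_smul_eq_zero_rat
      (by exact_mod_cast (memberOK_common h).1) t' h9) ht Q

/-- **Row form, all torsion**: both members of an `ok` row (as delivered by a display theorem via
`HSatRow.ok_of_hsatCheck`): the recorded generators are not in `3·E(ℚ) + E(ℚ)_tors`. With `rank E(ℚ) = 1`: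
`3 ∤ [E(ℚ) : ℤG + E(ℚ)_tors]` for both members. [folklore] -/
theorem HSatRow.sound_allTorsion_of_ok {r : HSatRow} (h : r.ok = true) :
    (∀ (t : (mordellCurve (r.k : ℚ)).toAffine.Point), IsOfFinAddOrder t →
      ∀ Q : (mordellCurve (r.k : ℚ)).toAffine.Point,
        (3 : ℕ) • Q + t ≠ .some _ _ (nonsingular_gen_of_memberOK ((HSatRow.ok_iff r).mp h).1)) ∧
    (∀ (t : (mordellCurve (r.k' : ℚ)).toAffine.Point), IsOfFinAddOrder t →
      ∀ Q : (mordellCurve (r.k' : ℚ)).toAffine.Point,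
        (3 : ℕ) • Q + t ≠ .some _ _ (nonsingular_gen_of_memberOK ((HSatRow.ok_iff r).mp h).2)) :=
  ⟨fun _ ht Q => memberOK_sound_allTorsion ((HSatRow.ok_iff r).mp h).1 ht Q,
    fun _ ht Q => memberOK_sound_allTorsion ((HSatRow.ok_iff r).mp h).2 ht Q⟩

end Summit.BirchSwinnertonDyer.Rank1Residual.X12.CMRamifiedRecords

end
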